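import Literature.Algebra.Homology.ExactCoupleEuler
import HarnessLib

/-!
# Deligne's degeneration criterion for the spectral sequence of a homology exact couple

Topic `Literature/Algebra/Homology`, sibling of `ExactCoupleEuler.lean` (the pages `E^{ρ+1} = Zʳ/Bʳ`,
the differentials `dZ ρ` and the abutment of an unrolled homology exact couple over a division ring,
E. H. Spanier, *Algebraic Topology* (1981), Ch. 9, Sec. 1, Ex. 6). This file adds the algebraic
half of P. Deligne, *Théorème de Lefschetz et critères de dégénérescence de suites spectrales*,
Publ. Math. IHÉS 35 (1968), Thm. 1.5 and (2.4), in the form printed in C. Voisin, *Hodge Theory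
and Complex Algebraic Geometry II* (CUP 2003), Thm. 4.15 (PDF p. 125 of the held copy): for a
projective submersion the Leray spectral sequence degenerates at `E₂`, because cup-product with
the relatively ample class `L = [ω] ∪ ·` is a morphism of spectral sequences (Lemma 4.13, "`L`
commutes with the differentials `d_r`") inducing the hard Lefschetz isomorphisms
`Lᵏ : Rⁿ⁻ᵏφ_*ℚ ≅ Rⁿ⁺ᵏφ_*ℚ` on `E₂`, and an `sl₂`-type induction then kills every `d_r`, `r ≥ 2`.

Here everything is abstract linear algebra on a `HomologyExactCouple K` (so that it applies to the
HOMOLOGY spectral sequence of the filtration `p⁻¹(Bˢ)` of the total space of a fibre bundle over a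
CW complex, `FiltrationExactCouple.lean`, with `L` the cap product with a degree-`2` class):

* `subQuotMap` — functoriality of the sub-quotients `Z/(B ∩ Z)` with injectivity/surjectivity
  criteria, and `subQuotMap_ker_range_bijective` (a comparison of three-term complexes which is
  onto–bijective–into induces a bijection on the middle homology);
* `iterDown L i m : V (m + 2i) → V m` — iterates of a degree-`-2` operator on an `ℕ`-graded
  family (power outside, so that all indices are literal successors), index casts `castLE` and the
  re-indexing `iterDown_shift`, conjugation `bijective_iterDown_iff_of_conj`, and `iterDown_comm`;
* **`deligne_d_eq_zero`** — Deligne's lemma for ONE differential: if `d : V → W` (degree `0`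
  between two graded families) commutes with `L`, `L` satisfies hard Lefschetz on `V` about `c_V`
  and on `W` about `c_W < c_V` in the range `i ≤ n₀`, and `V`, `W` vanish outside the Lefschetz
  window, then `d = 0` — proved by downward induction on the degree (`Lʲ d x = d Lʲ x` with `Lʲ`
  injective on the target and `Lʲ x` either zero or an `L^{j'} y` with `deg y > deg x`), i.e. the
  printed argument with the Lefschetz decomposition unrolled;
* `HomologyExactCouple.dPage` — `d^{ρ+1}` on the page (it kills `B^{ρ+1}`);
* `HomologyExactCouple.Zr_Br_succ_eq_of_dZ_eq_zero` — `d^{ρ+1} = 0` everywhere gives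
  `Z^{ρ+2} = Z^{ρ+1}`, `B^{ρ+2} = B^{ρ+1}` (`dZ_eq_zero_iff`, `range_dZ`);
* `HomologyExactCouple.LefschetzEndo C` — a degree-`(0, -2)` endomorphism `(L_A, L_E)` of the
  couple commuting with `ι`, `j`, `δ`; it preserves `Zʳ`, `Bʳ` (`LE_mem_Zr`, `LE_mem_Br`), acts on
  the pages (`Lpage`) and commutes with `dZ`/`dPage` (`dZ_LE`, `dPage_Lpage`) and with `d¹`;
* `EHardLefschetz L n₀` / `PageHardLefschetz L ρ n₀` — hard Lefschetz for `L` on `E = E¹` / on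
  `E^{ρ+1}`, centred at fibre degree `n₀` (`Lⁱ : E_{s, s+n₀+i} ≅ E_{s, s+n₀-i}` in total degrees,
  written `lo + i = s + n₀`);
* `pageHardLefschetz_one` — hard Lefschetz passes from `E¹` to `E² = H(E¹, d¹)` (`Lⁱ` is an
  isomorphism of the three-term `d¹`-complexes in symmetric degrees);
  `dZ_eq_zero_of_pageHardLefschetz` — Deligne's step on `E^{ρ+1}`, `ρ ≥ 1`;
  `pageHardLefschetz_of_eq` — hard Lefschetz survives to the next (equal) page;
* **`dZ_eq_zero_of_eHardLefschetz`** — the degeneration theorem: hard Lefschetz on `E¹` and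
  `E_{s,q} = 0` unless `s ≤ q ≤ s + 2n₀` imply `d^r = 0` for all `r ≥ 2`;
* **`Kinf_zero_eq_Kr_one_of_eHardLefschetz`** — the edge consequence used for invariant cycles
  (Voisin II, Thm. 4.18 in homological form): `ker (H_q(X₀) → H_q(X)) = ker (H_q(X₀) → H_q(X₁))`.

Everything is a definition with a body or a proved theorem; no named fact is introduced (D-0026).
This is the algebraic brick of the tree's programme for
`Literature.AlgebraicGeometry.Motives.Voisin2003_invariantCycles` (Voisin II, Thm. 4.18).

## References

* P. Deligne, *Théorème de Lefschetz et critères de dégénérescence de suites spectrales*, Publ.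
  Math. IHÉS 35 (1968), 107–126, Thm. 1.5, (2.4). [Deligne1968]
* C. Voisin, *Hodge Theory and Complex Algebraic Geometry II*, CUP (2003), §4.2.2 Lemma 4.13,
  Thm. 4.15, §4.3.1, Thm. 4.18 (held copy, PDF pp. 124–126). [VoisinHodgeII2003]
* E. H. Spanier, *Algebraic Topology*, Springer (1981), Ch. 9, Sec. 1, Ex. 6. [Spanier1981]

## Mathlib status (pin v4.32.0)

`Mathlib.Algebra.Homology.SpectralObject` / `SpectralSequence` build pages of spectral objects in
abelian categories but carry no Lefschetz-type degeneration criterion; the elementary sub-quotient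
model of `ExactCoupleEuler.lean` is kept so that the result plugs into `FiltrationExactCouple.lean`.
-/

open Module Function

namespace Literature.Algebra.Homology

universe u v w

variable {K : Type u} [DivisionRing K]

/-! ### Functoriality of sub-quotients -/

section SubQuotMap

variable {V : Type v} [AddCommGroup V] [Module K V] {W : Type w} [AddCommGroup W] [Module K W]
  {V₃ : Type*} [AddCommGroup V₃] [Module K V₃]

/-- **The map of sub-quotients `Z/(B ∩ Z) → Z'/(B' ∩ Z')` induced by a linear map `f` with
`f(Z) ⊆ Z'` and `f(B) ⊆ B'`.** [folklore] -/
def subQuotMap (f : V →ₗ[K] W) (Z B : Submodule K V) (Z' B' : Submodule K W)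
    (hZ : ∀ z ∈ Z, f z ∈ Z') (hB : ∀ b ∈ B, f b ∈ B') : SubQuot Z B →ₗ[K] SubQuot Z' B' :=
  (B.comap Z.subtype).mapQ (B'.comap Z'.subtype)
    (LinearMap.codRestrict Z' (f ∘ₗ Z.subtype) fun z => hZ z z.2) fun z hz => by
      simpa only [Submodule.mem_comap, Submodule.subtype_apply, LinearMap.codRestrict_apply,
        LinearMap.comp_apply] using hB _ hz

/-- `subQuotMap f [z] = [f z]`. [folklore] -/
@[simp]
theorem subQuotMap_mk (f : V →ₗ[K] W) (Z B : Submodule K V) (Z' B' : Submodule K W)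
    (hZ : ∀ z ∈ Z, f z ∈ Z') (hB : ∀ b ∈ B, f b ∈ B') (z : Z) :
    subQuotMap f Z B Z' B' hZ hB (Submodule.Quotient.mk z) =
      Submodule.Quotient.mk ⟨f z, hZ z z.2⟩ := rfl

/-- **Injectivity criterion**: `Z/(B ∩ Z) → Z'/(B' ∩ Z')` is injective as soon as
`f z ∈ B' ⇒ z ∈ B` on `Z`. [folklore] -/
theorem subQuotMap_injective (f : V →ₗ[K] W) (Z B : Submodule K V) (Z' B' : Submodule K W)
    (hZ : ∀ z ∈ Z, f z ∈ Z') (hB : ∀ b ∈ B, f b ∈ B') (h : ∀ z ∈ Z, f z ∈ B' → z ∈ B) :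
    Injective (subQuotMap f Z B Z' B' hZ hB) := by
  rw [← LinearMap.ker_eq_bot, Submodule.eq_bot_iff]
  intro x hx
  obtain ⟨z, rfl⟩ := Submodule.Quotient.mk_surjective _ x
  rw [LinearMap.mem_ker, subQuotMap_mk, subQuot_mk_eq_zero_iff] at hx
  exact (subQuot_mk_eq_zero_iff z).2 (h z z.2 hx)

/-- **Surjectivity criterion**: `Z/(B ∩ Z) → Z'/(B' ∩ Z')` is surjective as soon as every
`z' ∈ Z'` is `f z` modulo `B'` for some `z ∈ Z`. [folklore] -/
theorem subQuotMap_surjective (f : V →ₗ[K] W) (Z B : Submodule K V) (Z' B' : Submodule K W)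
    (hZ : ∀ z ∈ Z, f z ∈ Z') (hB : ∀ b ∈ B, f b ∈ B')
    (h : ∀ z' ∈ Z', ∃ z ∈ Z, f z - z' ∈ B') : Surjective (subQuotMap f Z B Z' B' hZ hB) := by
  intro x
  obtain ⟨z', rfl⟩ := Submodule.Quotient.mk_surjective _ x
  obtain ⟨z, hz, hzz'⟩ := h z' z'.2
  refine ⟨Submodule.Quotient.mk ⟨z, hz⟩, ?_⟩
  rw [subQuotMap_mk, Submodule.Quotient.eq, Submodule.mem_comap]
  exact hzz'

/-- Functoriality: `subQuotMap (g ∘ f) = subQuotMap g ∘ subQuotMap f`, applied. [folklore] -/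
theorem subQuotMap_comp_apply (f : V →ₗ[K] W) (g : W →ₗ[K] V₃) (Z B : Submodule K V)
    (Z' B' : Submodule K W) (Z'' B'' : Submodule K V₃)
    (hZ : ∀ z ∈ Z, f z ∈ Z') (hB : ∀ b ∈ B, f b ∈ B')
    (hZ' : ∀ z ∈ Z', g z ∈ Z'') (hB' : ∀ b ∈ B', g b ∈ B'')
    (hZ'' : ∀ z ∈ Z, (g ∘ₗ f) z ∈ Z'') (hB'' : ∀ b ∈ B, (g ∘ₗ f) b ∈ B'') (x : SubQuot Z B) :
    subQuotMap g Z' B' Z'' B'' hZ' hB' (subQuotMap f Z B Z' B' hZ hB x) =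
      subQuotMap (g ∘ₗ f) Z B Z'' B'' hZ'' hB'' x := by
  obtain ⟨z, rfl⟩ := Submodule.Quotient.mk_surjective _ x
  rfl

/-- The map induced by the identity is the identity. [folklore] -/
theorem subQuotMap_id_apply (Z B : Submodule K V) (hZ : ∀ z ∈ Z, LinearMap.id (R := K) z ∈ Z)
    (hB : ∀ b ∈ B, LinearMap.id (R := K) b ∈ B) (x : SubQuot Z B) :
    subQuotMap LinearMap.id Z B Z B hZ hB x = x := by
  obtain ⟨z, rfl⟩ := Submodule.Quotient.mk_surjective _ x
  rfl

/-- **Comparison of sub-quotients along inclusions of the data** `Z ≤ Z'`, `B ≤ B'` (the map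
induced by the identity); bijective when `Z = Z'` and `B = B'`. [folklore] -/
theorem subQuotMap_id_bijective {Z B Z' B' : Submodule K V} (hZ : Z = Z') (hB : B = B') :
    Bijective (subQuotMap LinearMap.id Z B Z' B' (fun _ hz => hZ ▸ hz) (fun _ hb => hB ▸ hb)) := by
  subst hZ hB
  constructor
  · exact subQuotMap_injective _ _ _ _ _ _ _ fun z _ h => h
  · exact subQuotMap_surjective _ _ _ _ _ _ _ fun z' hz' => ⟨z', hz', by simp⟩

/-- **Homology of a three-term complex under a comparison map.** Given `V₁ → V₂ → V₃` and
`V₁' → V₂' → V₃'` (linear maps `f, g` and `f', g'`) and vertical maps `u₁, u₂, u₃` making the two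
squares commute, with `u₁` onto, `u₂` bijective and `u₃` one-to-one, the map induced by `u₂` on
`ker g / im f → ker g' / im f'` is bijective. [folklore] -/
theorem subQuotMap_ker_range_bijective {V₁ : Type*} [AddCommGroup V₁] [Module K V₁]
    {V₁' : Type*} [AddCommGroup V₁'] [Module K V₁'] {V₃' : Type*} [AddCommGroup V₃'] [Module K V₃']
    (f : V₁ →ₗ[K] V) (g : V →ₗ[K] V₃) (f' : V₁' →ₗ[K] W) (g' : W →ₗ[K] V₃')
    (u₁ : V₁ →ₗ[K] V₁') (u₂ : V →ₗ[K] W) (u₃ : V₃ →ₗ[K] V₃')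
    (h₁ : ∀ x, u₂ (f x) = f' (u₁ x)) (h₂ : ∀ y, u₃ (g y) = g' (u₂ y))
    (hu₁ : Surjective u₁) (hu₂ : Bijective u₂) (hu₃ : Injective u₃)
    (hZ : ∀ z ∈ LinearMap.ker g, u₂ z ∈ LinearMap.ker g')
    (hB : ∀ b ∈ LinearMap.range f, u₂ b ∈ LinearMap.range f') :
    Bijective (subQuotMap u₂ (LinearMap.ker g) (LinearMap.range f) (LinearMap.ker g')
      (LinearMap.range f') hZ hB) := by
  constructor
  · refine subQuotMap_injective _ _ _ _ _ _ _ fun z _ hz => ?_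
    obtain ⟨y', hy'⟩ := LinearMap.mem_range.1 hz
    obtain ⟨y, rfl⟩ := hu₁ y'
    rw [← h₁] at hy'
    exact LinearMap.mem_range.2 ⟨y, hu₂.1 hy'⟩
  · refine subQuotMap_surjective _ _ _ _ _ _ _ fun z' hz' => ?_
    obtain ⟨z, rfl⟩ := hu₂.2 z'
    refine ⟨z, ?_, by simp⟩
    rw [LinearMap.mem_ker] at hz' ⊢
    apply hu₃
    rw [h₂, hz', map_zero]

end SubQuotMap

/-! ### Iterates of a degree `-2` operator on an `ℕ`-graded family; index casts -/

section Graded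

variable {V : ℕ → Type v} [∀ m, AddCommGroup (V m)] [∀ m, Module K (V m)]
  {W : ℕ → Type w} [∀ m, AddCommGroup (W m)] [∀ m, Module K (W m)]

/-- **The iterate `Lⁱ : V (m + 2i) → V m`** of a family of operators `L m : V (m + 2) → V m`
lowering the degree by `2` (`L⁰ = id`, `Lⁱ⁺¹ = Lⁱ ∘ L`). [folklore] -/
def iterDown (L : ∀ m, V (m + 2) →ₗ[K] V m) : ∀ (i m : ℕ), V (m + 2 * i) →ₗ[K] V m
  | 0, _ => LinearMap.id
  | i + 1, m => iterDown L i m ∘ₗ L (m + 2 * i)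

omit [∀ m, AddCommGroup (W m)] [∀ m, Module K (W m)] in
/-- `L⁰ = id`. [folklore] -/
@[simp]
theorem iterDown_zero (L : ∀ m, V (m + 2) →ₗ[K] V m) (m : ℕ) (x : V m) : iterDown L 0 m x = x :=
  rfl

omit [∀ m, AddCommGroup (W m)] [∀ m, Module K (W m)] in
/-- `Lⁱ⁺¹ x = Lⁱ (L x)`. [folklore] -/
theorem iterDown_succ (L : ∀ m, V (m + 2) →ₗ[K] V m) (i m : ℕ) (x : V (m + 2 * i + 2)) :
    iterDown L (i + 1) m x = iterDown L i m (L (m + 2 * i) x) :=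
  rfl

variable (K V) in
/-- The identification `V a → V a'` along an equality of indices `a = a'`. [folklore] -/
def castLE : ∀ {a a' : ℕ}, a = a' → (V a →ₗ[K] V a')
  | _, _, rfl => LinearMap.id

omit [∀ m, AddCommGroup (W m)] [∀ m, Module K (W m)] in
/-- `castLE rfl = id`. [folklore] -/
@[simp]
theorem castLE_rfl (a : ℕ) (x : V a) : castLE K V rfl x = x := rfl

omit [∀ m, AddCommGroup (W m)] [∀ m, Module K (W m)] in
/-- Index casts are bijective. [folklore] -/
theorem castLE_bijective {a a' : ℕ} (h : a = a') : Bijective (castLE K V h) := by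
  subst h; exact bijective_id

omit [∀ m, AddCommGroup (W m)] [∀ m, Module K (W m)] in
/-- `castLE h x = 0 ↔ x = 0`. [folklore] -/
theorem castLE_eq_zero_iff {a a' : ℕ} (h : a = a') (x : V a) : castLE K V h x = 0 ↔ x = 0 := by
  subst h; exact Iff.rfl

omit [∀ m, AddCommGroup (W m)] [∀ m, Module K (W m)] in
/-- Membership in a family of submodules is invariant under index casts. [folklore] -/
theorem mem_castLE_iff (P : ∀ a, Submodule K (V a)) {a a' : ℕ} (h : a = a') (x : V a) :
    castLE K V h x ∈ P a' ↔ x ∈ P a := by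
  subst h; exact Iff.rfl

omit [∀ m, AddCommGroup (W m)] [∀ m, Module K (W m)] in
/-- Degree-`-2` operators commute with index casts. [folklore] -/
theorem apply_castLE (L : ∀ m, V (m + 2) →ₗ[K] V m) {a a' : ℕ} (h : a = a') (x : V (a + 2)) :
    L a' (castLE K V (congrArg (· + 2) h) x) = castLE K V h (L a x) := by
  subst h; rfl

/-- Degree-`0` maps between two families commute with index casts. [folklore] -/
theorem apply_castLE₀ (d : ∀ m, V m →ₗ[K] W m) {a a' : ℕ} (h : a = a') (x : V a) :
    d a' (castLE K V h x) = castLE K W h (d a x) := by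
  subst h; rfl

omit [∀ m, AddCommGroup (W m)] [∀ m, Module K (W m)] in
/-- Iterates commute with index casts. [folklore] -/
theorem iterDown_castLE (L : ∀ m, V (m + 2) →ₗ[K] V m) (i : ℕ) {a a' : ℕ} (h : a = a')
    (x : V (a + 2 * i)) :
    iterDown L i a' (castLE K V (congrArg (· + 2 * i) h) x) = castLE K V h (iterDown L i a x) := by
  subst h; rfl

omit [∀ m, AddCommGroup (W m)] [∀ m, Module K (W m)] in
/-- **Re-indexing the iterates of the shifted family** `m ↦ L (m + 1)`:
`(L(·+1))ⁱ` at `lo` is `Lⁱ` at `lo + 1` up to the index cast `lo + 2i + 1 = lo + 1 + 2i`.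
[folklore] -/
theorem iterDown_shift (L : ∀ m, V (m + 2) →ₗ[K] V m) :
    ∀ (i lo : ℕ) (x : V (lo + 2 * i + 1)),
      iterDown (V := fun m => V (m + 1)) (fun m => L (m + 1)) i lo x =
        iterDown L i (lo + 1) (castLE K V (by omega) x)
  | 0, lo, x => by simp [iterDown]
  | i + 1, lo, x => by
    rw [iterDown_succ, iterDown_shift L i lo, iterDown_succ]
    congr 1
    have h : lo + 2 * i + 1 = lo + 1 + 2 * i := by omega
    rw [show (castLE K V (by omega : lo + 2 * i + 1 + 2 = lo + 1 + 2 * i + 2) x) =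
      castLE K V (congrArg (· + 2) h) x from rfl, apply_castLE L h]

omit [∀ m, AddCommGroup (W m)] [∀ m, Module K (W m)] in
/-- Bijectivity of `Lⁱ : V (lo + 1 + 2i) → V (lo + 1)` in terms of the shifted family. [folklore] -/
theorem bijective_iterDown_shift_iff (L : ∀ m, V (m + 2) →ₗ[K] V m) (i lo : ℕ) :
    Bijective (iterDown (V := fun m => V (m + 1)) (fun m => L (m + 1)) i lo) ↔
      Bijective (iterDown L i (lo + 1)) := by
  have hfun : (iterDown (V := fun m => V (m + 1)) (fun m => L (m + 1)) i lo : _ → _) =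
      iterDown L i (lo + 1) ∘ castLE K V (by omega : lo + 2 * i + 1 = lo + 1 + 2 * i) :=
    funext fun x => iterDown_shift L i lo x
  rw [hfun]
  constructor
  · intro h
    exact (Bijective.of_comp_iff _ (castLE_bijective _)).1 h
  · intro h
    exact h.comp (castLE_bijective _)

/-- **Iterated commutation**: if `d ∘ L = L ∘ d` then `d ∘ Lⁱ = Lⁱ ∘ d`. [folklore] -/
theorem iterDown_comm (LV : ∀ m, V (m + 2) →ₗ[K] V m) (LW : ∀ m, W (m + 2) →ₗ[K] W m)
    (d : ∀ m, V m →ₗ[K] W m) (hcomm : ∀ m (x : V (m + 2)), d m (LV m x) = LW m (d (m + 2) x)) :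
    ∀ (i m : ℕ) (x : V (m + 2 * i)), d m (iterDown LV i m x) = iterDown LW i m (d (m + 2 * i) x)
  | 0, _, _ => rfl
  | i + 1, m, x => by
    rw [iterDown_succ, iterDown_succ, iterDown_comm LV LW d hcomm i m, hcomm]
    rfl

/-! ### Deligne's vanishing lemma for one differential -/

/-- **Deligne's lemma (one differential, `sl₂`-free form).** Let `V`, `W` be `ℕ`-graded families
with degree-`-2` operators `L` and a degree-`0` map `d : V → W` commuting with `L`. Suppose `L`
satisfies hard Lefschetz on `V` about the centre `c_V` and on `W` about `c_W`, in the range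
`i ≤ n₀` (`Lⁱ : V (c_V + i) → V (c_V - i)` bijective), that `V` vanishes in degrees
`> c_V + n₀` and `< c_V - n₀`, `W` vanishes in degrees `> c_W + n₀`, and that `c_W < c_V`
(`d` raises the distance to the top). Then `d = 0`. This is the inductive step of P. Deligne,
*Théorème de Lefschetz et critères de dégénérescence de suites spectrales*, Publ. Math. IHÉS 35
(1968), proof of Thm. 1.5 / C. Voisin, *Hodge Theory and Complex Algebraic Geometry II* (2003),
proof of Thm. 4.15, run by downward induction on the degree instead of through the Lefschetz
decomposition. [cite: VoisinHodgeII2003, Thm. 4.15 (proof)] -/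
theorem deligne_d_eq_zero (LV : ∀ m, V (m + 2) →ₗ[K] V m) (LW : ∀ m, W (m + 2) →ₗ[K] W m)
    (d : ∀ m, V m →ₗ[K] W m) (hcomm : ∀ m (x : V (m + 2)), d m (LV m x) = LW m (d (m + 2) x))
    {cV cW n₀ : ℕ} (hc : cW < cV) (hn : n₀ ≤ cW)
    (hV : ∀ lo i, lo + i = cV → i ≤ n₀ → Bijective (iterDown LV i lo))
    (hW : ∀ lo i, lo + i = cW → i ≤ n₀ → Bijective (iterDown LW i lo))
    (hVhi : ∀ m, cV + n₀ < m → ∀ x : V m, x = 0)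
    (hVlo : ∀ m, m + n₀ < cV → ∀ x : V m, x = 0)
    (hWhi : ∀ m, cW + n₀ < m → ∀ x : W m, x = 0) (m : ℕ) (x : V m) : d m x = 0 := by
  -- (I) degrees `m ≥ cV`, by downward induction on `m` (`k` bounds `cV + n₀ + 1 - m`)
  have upper : ∀ k m, cV ≤ m → cV + n₀ < m + k → ∀ x : V m, d m x = 0 := by
    intro k
    induction k with
    | zero =>
      intro m _ htop x
      rw [hVhi _ (by omega) x, map_zero]
    | succ k ih =>
      intro m hcm htop x
      by_cases hWm : cW + n₀ < m
      · -- the target vanishes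
        exact hWhi m hWm _
      -- write `m = lo + 2j`, `cW = lo + j`: `Lʲ : W m → W lo` is injective; commute it past `d`
      push Not at hWm
      obtain ⟨lo, j, hlo, rfl⟩ : ∃ lo j, lo + j = cW ∧ m = lo + 2 * j :=
        ⟨2 * cW - m, m - cW, by omega, by omega⟩
      apply (hW lo j hlo (by omega)).1
      rw [map_zero, ← iterDown_comm LV LW d hcomm j lo x]
      -- the element `Lʲ x ∈ V lo`
      by_cases hlo' : lo + n₀ < cV
      · rw [hVlo lo hlo' (iterDown LV j lo x), map_zero]
      · -- `lo` is within the Lefschetz range of `V`: `Lʲ x = L^{j'} y` with `deg y > m`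
        obtain ⟨j', hj'⟩ : ∃ j', lo + j' = cV := ⟨cV - lo, by omega⟩
        obtain ⟨y, hy⟩ := (hV lo j' hj' (by omega)).2 (iterDown LV j lo x)
        rw [← hy, iterDown_comm LV LW d hcomm j' lo y, ih (lo + 2 * j') (by omega) (by omega) y,
          map_zero]
  have upper' : ∀ m, cV ≤ m → ∀ x : V m, d m x = 0 := fun m hm x =>
    upper (cV + n₀ + 1) m hm (by omega) x
  -- (II) degrees `m < cV`: `x = Lⁱ y` with `deg y ≥ cV`
  by_cases hm : cV ≤ m
  · exact upper' m hm x
  by_cases hlo : m + n₀ < cV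
  · rw [hVlo m hlo x, map_zero]
  obtain ⟨i, hi⟩ : ∃ i, m + i = cV := ⟨cV - m, by omega⟩
  obtain ⟨y, rfl⟩ := (hV m i hi (by omega)).2 x
  rw [iterDown_comm LV LW d hcomm i m y, upper' (m + 2 * i) (by omega) y, map_zero]

/-- **Conjugation**: a family of bijections intertwining two degree-`-2` operators identifies the
bijectivity of their iterates. [folklore] -/
theorem bijective_iterDown_iff_of_conj {V' : ℕ → Type w} [∀ m, AddCommGroup (V' m)]
    [∀ m, Module K (V' m)] (L : ∀ m, V (m + 2) →ₗ[K] V m) (L' : ∀ m, V' (m + 2) →ₗ[K] V' m)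
    (φ : ∀ m, V m →ₗ[K] V' m) (hφ : ∀ m, Bijective (φ m))
    (hcomm : ∀ m (x : V (m + 2)), φ m (L m x) = L' m (φ (m + 2) x)) (i lo : ℕ) :
    Bijective (iterDown L i lo) ↔ Bijective (iterDown L' i lo) := by
  have hfun : (φ lo : V lo → V' lo) ∘ iterDown L i lo = iterDown L' i lo ∘ φ (lo + 2 * i) :=
    funext fun x => iterDown_comm L L' φ hcomm i lo x
  constructor
  · intro h
    have h2 : Bijective ((φ lo : V lo → V' lo) ∘ iterDown L i lo) := (hφ lo).comp h
    rw [hfun] at h2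
    exact (Bijective.of_comp_iff _ (hφ _)).1 h2
  · intro h
    have h2 : Bijective (iterDown L' i lo ∘ (φ (lo + 2 * i) : V (lo + 2 * i) → V' (lo + 2 * i))) :=
      h.comp (hφ _)
    rw [← hfun] at h2
    exact (Bijective.of_comp_iff' (hφ lo) _).1 h2

end Graded

/-! ### Lefschetz endomorphisms of a homology exact couple -/

namespace HomologyExactCouple

variable (C : HomologyExactCouple.{u, v} K)

/-- **The differential `d^{ρ+1}` on the page** `E^{ρ+1}` at `(t + ρ + 1, q + 1)` (the map `dZ`,
which is defined on the cycles `Z^{ρ+1}`, kills the boundaries `B^{ρ+1} = j (ker ι^ρ)` since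
`δ ∘ j = 0`). [cite: Spanier1981, Ch. 9 Sec. 1 Ex. 6] -/
noncomputable def dPage (ρ t q : ℕ) : C.page ρ (t + ρ + 1) (q + 1) →ₗ[K] C.page ρ t q :=
  ((C.Br ρ (t + ρ + 1) (q + 1)).comap (C.Zr ρ (t + ρ + 1) (q + 1)).subtype).liftQ (C.dZ ρ t q)
    fun z hz => by
      rw [LinearMap.mem_ker]
      rw [Submodule.mem_comap, Submodule.subtype_apply] at hz
      obtain ⟨k, -, hkz⟩ := Submodule.mem_map.1 hz
      have hδ : C.δ (t + ρ) q z = 0 := by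
        have hmem : (z : C.E (t + ρ + 1) (q + 1)) ∈ LinearMap.ker (C.δ (t + ρ) q) := by
          rw [← C.range_j_succ_succ]
          exact ⟨k, hkz⟩
        exact hmem
      rw [C.dZ_apply_of_eq ρ t q z 0 (by rw [map_zero, hδ])]
      have h0 : (⟨C.j t q 0, C.j_mem_Zr ρ t q 0⟩ : C.Zr ρ t q) = 0 := Subtype.ext (map_zero _)
      rw [h0, Submodule.Quotient.mk_zero]

/-- `dPage [z] = dZ z`. [folklore] -/
@[simp]
theorem dPage_mk (ρ t q : ℕ) (z : C.Zr ρ (t + ρ + 1) (q + 1)) :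
    C.dPage ρ t q (Submodule.Quotient.mk z) = C.dZ ρ t q z := rfl

/-- `d^{ρ+1} = 0` on the page iff it vanishes on all cycles. [folklore] -/
theorem dPage_eq_zero_iff (ρ t q : ℕ) :
    (∀ x, C.dPage ρ t q x = 0) ↔ ∀ z, C.dZ ρ t q z = 0 := by
  constructor
  · intro h z
    rw [← dPage_mk]
    exact h _
  · intro h x
    obtain ⟨z, rfl⟩ := Submodule.Quotient.mk_surjective _ x
    exact h z

/-- Pages are trivial where `E` is. [folklore] -/
theorem page_eq_zero (ρ s q : ℕ) (h : ∀ x : C.E s q, x = 0) (x : C.page ρ s q) : x = 0 := by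
  obtain ⟨z, rfl⟩ := Submodule.Quotient.mk_surjective _ x
  have hz : z = 0 := Subtype.ext (h z)
  rw [hz]
  rfl

/-- **If `d^{ρ+1} = 0` everywhere then `Z^{ρ+2} = Z^{ρ+1}` and `B^{ρ+2} = B^{ρ+1}`**: the page does
not change. [cite: Spanier1981, Ch. 9 Sec. 1 Ex. 6] -/
theorem Zr_Br_succ_eq_of_dZ_eq_zero {ρ : ℕ} (h : ∀ t q (z : C.Zr ρ (t + ρ + 1) (q + 1)), C.dZ ρ t q z = 0)
    (s q : ℕ) : C.Zr (ρ + 1) s q = C.Zr ρ s q ∧ C.Br (ρ + 1) s q = C.Br ρ s q := by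
  constructor
  · cases s with
    | zero => simp
    | succ s =>
      cases q with
      | zero => rfl
      | succ q =>
        by_cases hs : s + 1 ≤ ρ
        · exact C.Zr_succ_eq_of_le hs (q + 1)
        · obtain ⟨t, rfl⟩ : ∃ t, s = t + ρ := ⟨s - ρ, by omega⟩
          refine le_antisymm (C.Zr_succ_le ρ _ _) fun z hz => ?_
          exact (C.dZ_eq_zero_iff ρ t q ⟨z, hz⟩).1 (h t q ⟨z, hz⟩)
  · refine le_antisymm (fun x hx => ?_) (C.Br_succ ρ s q)
    have hxZ : x ∈ C.Zr ρ s q := C.Br_le_Zr (ρ + 1) ρ s q hx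
    have hrange : LinearMap.range (C.dZ ρ s q) = ⊥ := by
      rw [LinearMap.range_eq_bot, LinearMap.ext_iff]
      exact h s q
    rw [C.range_dZ ρ s q, ← LinearMap.le_ker_iff_map, Submodule.ker_mkQ] at hrange
    have hmem : (⟨x, hxZ⟩ : C.Zr ρ s q) ∈ (C.Br (ρ + 1) s q).comap (C.Zr ρ s q).subtype := hx
    exact hrange hmem

/-- **A Lefschetz endomorphism of an exact couple**: linear maps `L : H_{q+2}(X_s) → H_q(X_s)` and
`L : H_{q+2}(X_s, X_{s-1}) → H_q(X_s, X_{s-1})` of degree `(0, -2)` commuting with the three maps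
`ι`, `j`, `δ` of the couple — the shape of the cap product with a class `η ∈ H²(X)` restricted to
the stages of the filtration (Deligne 1968, §1; Voisin II, proof of Thm. 4.15: "the morphism `L`
… is compatible with the differentials `d_r`"). [cite: VoisinHodgeII2003, Thm. 4.15 (proof); Lemma 4.13] -/
structure LefschetzEndo where
  /-- `L` on `H_•(X_s)` -/
  LA (s q : ℕ) : C.A s (q + 2) →ₗ[K] C.A s q
  /-- `L` on `H_•(X_s, X_{s-1})` -/
  LE (s q : ℕ) : C.E s (q + 2) →ₗ[K] C.E s q
  /-- `L` commutes with the maps induced by the inclusions -/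
  comm_ι (q s s' : ℕ) (h : s ≤ s') (a : C.A s (q + 2)) :
    LA s' q (C.ι (q + 2) s s' h a) = C.ι q s s' h (LA s q a)
  /-- `L` commutes with `j` -/
  comm_j (s q : ℕ) (a : C.A s (q + 2)) : LE s q (C.j s (q + 2) a) = C.j s q (LA s q a)
  /-- `L` commutes with the connecting maps -/
  comm_δ (s q : ℕ) (x : C.E (s + 1) (q + 2 + 1)) :
    LA s q (C.δ s (q + 2) x) = C.δ s q (LE (s + 1) (q + 1) x)

namespace LefschetzEndo

variable {C} (L : C.LefschetzEndo)

/-- `L` preserves `ker ι^ρ`. [folklore] -/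
theorem LA_mem_Kr {ρ s q : ℕ} {a : C.A s (q + 2)} (ha : a ∈ C.Kr ρ s (q + 2)) :
    L.LA s q a ∈ C.Kr ρ s q := by
  change C.ι q s (s + ρ) _ (L.LA s q a) = 0
  rw [← L.comm_ι, show C.ι (q + 2) s (s + ρ) _ a = 0 from ha, map_zero]

/-- `L` preserves the boundaries `B^{ρ+1} = j (ker ι^ρ)`. [folklore] -/
theorem LE_mem_Br {ρ s q : ℕ} {x : C.E s (q + 2)} (hx : x ∈ C.Br ρ s (q + 2)) :
    L.LE s q x ∈ C.Br ρ s q := by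
  obtain ⟨a, ha, rfl⟩ := Submodule.mem_map.1 hx
  exact Submodule.mem_map.2 ⟨L.LA s q a, L.LA_mem_Kr ha, (L.comm_j s q a).symm⟩

/-- `L` preserves the images `ι^ρ (A_{s-ρ})`. [folklore] -/
theorem LA_mem_Im {ρ s q : ℕ} {a : C.A s (q + 2)} (ha : a ∈ C.Im ρ s (q + 2)) :
    L.LA s q a ∈ C.Im ρ s q := by
  unfold Im at ha ⊢
  split_ifs at ha ⊢ with h
  · obtain ⟨b, rfl⟩ := LinearMap.mem_range.1 ha
    exact LinearMap.mem_range.2 ⟨L.LA _ q b, (L.comm_ι q _ s _ b).symm⟩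
  · rw [Submodule.mem_bot] at ha ⊢
    rw [ha, map_zero]

/-- `L` preserves the cycles `Z^{ρ+1} = δ⁻¹(ι^ρ A)`. [folklore] -/
theorem LE_mem_Zr (ρ s q : ℕ) {x : C.E s (q + 2)} (hx : x ∈ C.Zr ρ s (q + 2)) :
    L.LE s q x ∈ C.Zr ρ s q := by
  cases s with
  | zero => simp
  | succ s =>
    cases q with
    | zero => simp
    | succ q =>
      have hx' : C.δ s (q + 2) x ∈ C.Im ρ s (q + 2) := hx
      rw [C.mem_Zr_succ_succ, ← L.comm_δ s q x]
      exact L.LA_mem_Im hx'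

/-- **`L` on the page `E^{ρ+1}`**. [cite: VoisinHodgeII2003, Thm. 4.15 (proof)] -/
def Lpage (ρ s q : ℕ) : C.page ρ s (q + 2) →ₗ[K] C.page ρ s q :=
  subQuotMap (L.LE s q) (C.Zr ρ s (q + 2)) (C.Br ρ s (q + 2)) (C.Zr ρ s q) (C.Br ρ s q)
    (fun _ hx => L.LE_mem_Zr ρ s q hx) (fun _ hx => L.LE_mem_Br hx)

/-- `Lpage [z] = [L z]`. [folklore] -/
@[simp]
theorem Lpage_mk (ρ s q : ℕ) (z : C.Zr ρ s (q + 2)) :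
    L.Lpage ρ s q (Submodule.Quotient.mk z) =
      Submodule.Quotient.mk ⟨L.LE s q z, L.LE_mem_Zr ρ s q z.2⟩ := rfl

/-- **`L` commutes with the differential `d^{ρ+1}`** (on cycles). [cite: VoisinHodgeII2003, Thm. 4.15 (proof)] -/
theorem dZ_LE (ρ t q : ℕ) (z : C.Zr ρ (t + ρ + 1) (q + 2 + 1)) :
    C.dZ ρ t q ⟨L.LE (t + ρ + 1) (q + 1) z, L.LE_mem_Zr ρ _ _ z.2⟩ =
      L.Lpage ρ t q (C.dZ ρ t (q + 2) z) := by
  obtain ⟨a, ha⟩ := C.δ_mem_range_of_mem_Zr ρ t (q + 2) z.2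
  rw [C.dZ_apply_of_eq ρ t (q + 2) z a ha, C.dZ_apply_of_eq ρ t q _ (L.LA t q a)]
  · rw [Lpage_mk]
    congr 1
    exact Subtype.ext (L.comm_j t q a).symm
  · rw [← L.comm_ι, ha]
    exact L.comm_δ (t + ρ) q z

/-- **`L` commutes with `d^{ρ+1}`** (on the pages). [cite: VoisinHodgeII2003, Thm. 4.15 (proof)] -/
theorem dPage_Lpage (ρ t q : ℕ) (x : C.page ρ (t + ρ + 1) (q + 2 + 1)) :
    C.dPage ρ t q (L.Lpage ρ (t + ρ + 1) (q + 1) x) = L.Lpage ρ t q (C.dPage ρ t (q + 2) x) := by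
  obtain ⟨z, rfl⟩ := Submodule.Quotient.mk_surjective _ x
  rw [Lpage_mk, dPage_mk, dPage_mk]
  exact L.dZ_LE ρ t q z

/-- `L` commutes with `d¹ = j ∘ δ`. [folklore] -/
theorem LE_dOne (s q : ℕ) (y : C.E (s + 1) (q + 2 + 1)) :
    L.LE s q (C.dOne s (q + 2) y) = C.dOne s q (L.LE (s + 1) (q + 1) y) := by
  simp only [dOne, LinearMap.comp_apply]
  rw [L.comm_j, L.comm_δ]

/-- The iterates `Lⁱ` preserve the cycles. [folklore] -/
theorem iterDown_LE_mem_Zr (ρ s : ℕ) :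
    ∀ (i lo : ℕ) {x : C.E s (lo + 2 * i)}, x ∈ C.Zr ρ s (lo + 2 * i) →
      iterDown (V := fun q => C.E s q) (L.LE s) i lo x ∈ C.Zr ρ s lo
  | 0, _, _, hx => hx
  | i + 1, lo, _, hx => iterDown_LE_mem_Zr ρ s i lo (L.LE_mem_Zr ρ s _ hx)

/-- The iterates `Lⁱ` preserve the boundaries. [folklore] -/
theorem iterDown_LE_mem_Br (ρ s : ℕ) :
    ∀ (i lo : ℕ) {x : C.E s (lo + 2 * i)}, x ∈ C.Br ρ s (lo + 2 * i) →
      iterDown (V := fun q => C.E s q) (L.LE s) i lo x ∈ C.Br ρ s lo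
  | 0, _, _, hx => hx
  | i + 1, lo, _, hx => iterDown_LE_mem_Br ρ s i lo (L.LE_mem_Br hx)

/-- `(Lpage)ⁱ [z] = [Lⁱ z]`. [folklore] -/
theorem iterDown_Lpage_mk (ρ s : ℕ) :
    ∀ (i lo : ℕ) (z : C.Zr ρ s (lo + 2 * i)),
      iterDown (V := fun q => C.page ρ s q) (L.Lpage ρ s) i lo (Submodule.Quotient.mk z) =
        Submodule.Quotient.mk ⟨iterDown (V := fun q => C.E s q) (L.LE s) i lo z,
          L.iterDown_LE_mem_Zr ρ s i lo z.2⟩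
  | 0, _, _ => rfl
  | i + 1, lo, z => by
    rw [iterDown_succ, Lpage_mk, iterDown_Lpage_mk ρ s i lo]
    rfl

/-! ### Hard Lefschetz on the pages and Deligne's degeneration -/

/-- **Hard Lefschetz for `L` on `E = E¹`, centred at fibre degree `n₀`**: in every filtration
`s`, `Lⁱ : E_{s, s+n₀+i} → E_{s, s+n₀-i}` (total degrees) is bijective for `i ≤ n₀` — the shape of
`E¹_{s,•} = ⊕_{s-cells} H_{•-s}(F)` with the hard Lefschetz isomorphisms of the fibres (Voisin II,
proof of Thm. 4.15: "the morphism `L` induces Lefschetz isomorphisms `Lᵏ : Rⁿ⁻ᵏφ_*ℚ ≅ Rⁿ⁺ᵏφ_*ℚ`").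
Written with `lo + i = s + n₀` so that no subtraction occurs. [cite: VoisinHodgeII2003, Thm. 4.15 (proof)] -/
def EHardLefschetz (n₀ : ℕ) : Prop :=
  ∀ s lo i : ℕ, lo + i = s + n₀ → i ≤ n₀ → Bijective (iterDown (V := fun q => C.E s q) (L.LE s) i lo)

/-- **Hard Lefschetz for `L` on the page `E^{ρ+1}`**, centred at fibre degree `n₀`.
[cite: VoisinHodgeII2003, Thm. 4.15 (proof)] -/
def PageHardLefschetz (ρ n₀ : ℕ) : Prop :=
  ∀ s lo i : ℕ, lo + i = s + n₀ → i ≤ n₀ →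
    Bijective (iterDown (V := fun q => C.page ρ s q) (L.Lpage ρ s) i lo)

section Degeneration

variable {n₀ : ℕ} (hlo : ∀ s q, q < s → ∀ x : C.E s q, x = 0)
  (hhi : ∀ s q, s + 2 * n₀ < q → ∀ x : C.E s q, x = 0)
include hlo hhi

/-- **Deligne's step: hard Lefschetz on `E^{ρ+1}` (`ρ ≥ 1`) forces `d^{ρ+1} = 0`**, for a couple
with `E_{s,q} = 0` unless `s ≤ q ≤ s + 2n₀` (Deligne 1968, proof of Thm. 1.5; Voisin II, proof of
Thm. 4.15). [cite: VoisinHodgeII2003, Thm. 4.15 (proof)] -/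
theorem dZ_eq_zero_of_pageHardLefschetz {ρ : ℕ} (hρ : 1 ≤ ρ) (hL : L.PageHardLefschetz ρ n₀)
    (t q : ℕ) (z : C.Zr ρ (t + ρ + 1) (q + 1)) : C.dZ ρ t q z = 0 := by
  revert z
  rw [← C.dPage_eq_zero_iff]
  intro x
  refine deligne_d_eq_zero (V := fun m => C.page ρ (t + ρ + 1) (m + 1)) (W := fun m => C.page ρ t m)
    (fun m => L.Lpage ρ (t + ρ + 1) (m + 1)) (fun m => L.Lpage ρ t m) (fun m => C.dPage ρ t m)
    (fun m x => L.dPage_Lpage ρ t m x) (cV := t + ρ + n₀) (cW := t + n₀) (n₀ := n₀)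
    (by omega) (by omega) ?_ ?_ ?_ ?_ ?_ q x
  · intro lo i hloi hi
    rw [bijective_iterDown_shift_iff (V := fun m => C.page ρ (t + ρ + 1) m)
      (fun m => L.Lpage ρ (t + ρ + 1) m) i lo]
    exact hL (t + ρ + 1) (lo + 1) i (by omega) hi
  · intro lo i hloi hi
    exact hL t lo i hloi hi
  · intro m hm x
    exact C.page_eq_zero ρ _ _ (hhi _ _ (by omega)) x
  · intro m hm x
    exact C.page_eq_zero ρ _ _ (hlo _ _ (by omega)) x
  · intro m hm x
    exact C.page_eq_zero ρ _ _ (hhi _ _ (by omega)) x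

omit hlo hhi in
/-- Hard Lefschetz passes between pages with the same cycles and boundaries. [folklore] -/
theorem pageHardLefschetz_of_eq {ρ ρ' : ℕ}
    (h : ∀ s q, C.Zr ρ' s q = C.Zr ρ s q ∧ C.Br ρ' s q = C.Br ρ s q)
    (hL : L.PageHardLefschetz ρ n₀) : L.PageHardLefschetz ρ' n₀ := by
  intro s lo i hloi hi
  -- the comparison maps `page ρ s m → page ρ' s m` induced by the identity
  let φ : ∀ m, C.page ρ s m →ₗ[K] C.page ρ' s m := fun m =>
    subQuotMap LinearMap.id (C.Zr ρ s m) (C.Br ρ s m) (C.Zr ρ' s m) (C.Br ρ' s m)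
      (fun _ hz => (h s m).1 ▸ hz) (fun _ hb => (h s m).2 ▸ hb)
  have hφ : ∀ m, Bijective (φ m) := fun m => subQuotMap_id_bijective (h s m).1.symm (h s m).2.symm
  rw [← bijective_iterDown_iff_of_conj (V := fun q => C.page ρ s q) (V' := fun q => C.page ρ' s q)
    (L.Lpage ρ s) (L.Lpage ρ' s) φ hφ ?_ i lo]
  · exact hL s lo i hloi hi
  · intro m x
    obtain ⟨z, rfl⟩ := Submodule.Quotient.mk_surjective _ x
    rfl

omit hlo hhi in
/-- **Hard Lefschetz passes from `E¹` to `E² = H(E¹, d¹)`**: `Lⁱ` is an isomorphism of the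
three-term complexes `E¹_{s+1} → E¹_s → E¹_{s-1}` in the symmetric degrees, hence induces an
isomorphism on their homology (Voisin II, proof of Thm. 4.15, first step). [cite: VoisinHodgeII2003, Thm. 4.15 (proof)] -/
theorem pageHardLefschetz_one (hL : L.EHardLefschetz n₀) : L.PageHardLefschetz 1 n₀ := by
  intro s lo i hloi hi
  -- `Lⁱ` on `E_s` (bijective) and the shifted iterate on `E_{s+1}` (bijective), commuting with `d¹`
  have hf := hL s lo i hloi hi
  have hfin : Bijective (iterDown (V := fun m => C.E (s + 1) (m + 1))
      (fun m => L.LE (s + 1) (m + 1)) i lo) := by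
    rw [bijective_iterDown_shift_iff (V := fun q => C.E (s + 1) q) (L.LE (s + 1)) i lo]
    exact hL (s + 1) (lo + 1) i (by omega) hi
  have hcomm : ∀ (s lo : ℕ) (y : C.E (s + 1) (lo + 2 * i + 1)),
      C.dOne s lo (iterDown (V := fun m => C.E (s + 1) (m + 1))
        (fun m => L.LE (s + 1) (m + 1)) i lo y) =
        iterDown (V := fun q => C.E s q) (L.LE s) i lo (C.dOne s (lo + 2 * i) y) := fun s lo y =>
    iterDown_comm (V := fun m => C.E (s + 1) (m + 1)) (W := fun q => C.E s q)
      (fun m => L.LE (s + 1) (m + 1)) (L.LE s) (fun m => C.dOne s m)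
      (fun m x => (L.LE_dOne s m x).symm) i lo y
  constructor
  · -- injectivity: `Lⁱ z ∈ im d¹` forces `z ∈ im d¹`
    rw [injective_iff_map_eq_zero]
    intro x hx
    obtain ⟨z, rfl⟩ := Submodule.Quotient.mk_surjective _ x
    rw [L.iterDown_Lpage_mk, subQuot_mk_eq_zero_iff] at hx
    simp only [C.Br_one, HomologyExactCouple.BOne] at hx
    obtain ⟨y, hy⟩ := LinearMap.mem_range.1 hx
    obtain ⟨y', rfl⟩ := hfin.2 y
    rw [hcomm] at hy
    have hz : C.dOne s (lo + 2 * i) y' = (z : C.E s (lo + 2 * i)) := hf.1 hy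
    apply (subQuot_mk_eq_zero_iff z).2
    simp only [C.Br_one, HomologyExactCouple.BOne]
    rw [← hz]
    exact LinearMap.mem_range_self _ _
  · -- surjectivity: `(Lⁱ)⁻¹ z'` is a `d¹`-cycle when `z'` is
    intro x'
    obtain ⟨z', rfl⟩ := Submodule.Quotient.mk_surjective _ x'
    cases s with
    | zero =>
      obtain ⟨z, hz⟩ := hf.2 (z' : C.E 0 lo)
      refine ⟨Submodule.Quotient.mk ⟨z, by simp⟩, ?_⟩
      rw [L.iterDown_Lpage_mk]
      congr 1
      exact Subtype.ext hz
    | succ s' =>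
      obtain ⟨lo', rfl⟩ : ∃ lo', lo = lo' + 1 := ⟨lo - 1, by omega⟩
      have hfsh : Bijective (iterDown (V := fun m => C.E (s' + 1) (m + 1))
          (fun m => L.LE (s' + 1) (m + 1)) i lo') := by
        rw [bijective_iterDown_shift_iff (V := fun q => C.E (s' + 1) q) (L.LE (s' + 1)) i lo']
        exact hf
      obtain ⟨w, hw⟩ := hfsh.2 (z' : C.E (s' + 1) (lo' + 1))
      -- `z'` is a `d¹`-cycle, hence so is `w`
      have hz' : C.dOne s' lo' z' = 0 := by
        have h2 : (z' : C.E (s' + 1) (lo' + 1)) ∈ C.ZOne (s' + 1) (lo' + 1) := by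
          rw [← C.Zr_one]
          exact z'.2
        exact h2
      have hwZ : w ∈ C.Zr 1 (s' + 1) (lo' + 2 * i + 1) := by
        rw [C.Zr_one]
        show C.dOne s' (lo' + 2 * i) w = 0
        apply (hL s' lo' i (by omega) hi).1
        rw [map_zero, ← hcomm s' lo' w, hw, hz']
      -- transport `w` to the index `lo' + 1 + 2 i`
      have e : lo' + 2 * i + 1 = lo' + 1 + 2 * i := by omega
      refine ⟨Submodule.Quotient.mk ⟨castLE K (fun q => C.E (s' + 1) q) e w,
        (mem_castLE_iff (V := fun q => C.E (s' + 1) q) (fun q => C.Zr 1 (s' + 1) q) e w).2 hwZ⟩, ?_⟩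
      rw [L.iterDown_Lpage_mk]
      congr 1
      apply Subtype.ext
      rw [iterDown_shift (V := fun q => C.E (s' + 1) q) (L.LE (s' + 1)) i lo' w] at hw
      exact hw

/-- **Deligne's degeneration theorem (abstract form).** If `L` satisfies hard Lefschetz on `E¹`
(centred at fibre degree `n₀`) and `E_{s,q} = 0` unless `s ≤ q ≤ s + 2n₀`, then all the
differentials `d^r`, `r ≥ 2`, of the spectral sequence vanish: `E² = E^∞` (P. Deligne 1968,
Thm. 1.5 / (2.4); Voisin II, Thm. 4.15: "the Leray spectral sequence of `φ` degenerates at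
`E₂`"). [cite: VoisinHodgeII2003, Thm. 4.15] -/
theorem dZ_eq_zero_of_eHardLefschetz (hL : L.EHardLefschetz n₀) {ρ : ℕ} (hρ : 1 ≤ ρ) (t q : ℕ)
    (z : C.Zr ρ (t + ρ + 1) (q + 1)) : C.dZ ρ t q z = 0 := by
  -- hard Lefschetz holds on every page `E^{ρ+1}`, `ρ ≥ 1`, by induction
  suffices H : ∀ k, L.PageHardLefschetz (k + 1) n₀ by
    obtain ⟨k, rfl⟩ : ∃ k, ρ = k + 1 := ⟨ρ - 1, by omega⟩
    exact L.dZ_eq_zero_of_pageHardLefschetz hlo hhi hρ (H k) t q z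
  intro k
  induction k with
  | zero => exact L.pageHardLefschetz_one hL
  | succ k ih =>
    exact L.pageHardLefschetz_of_eq
      (C.Zr_Br_succ_eq_of_dZ_eq_zero (L.dZ_eq_zero_of_pageHardLefschetz hlo hhi (by omega) ih)) ih

/-- **The edge: under degeneration, a class of `H_q(X₀)` dies in `H_q(X)` iff it dies in
`H_q(X₁)`** (`ker φ₀ = ker ι₀₁`: the abutment filtration starts with `E^∞_{0,q} = E²_{0,q}`;
Voisin II, Thm. 4.18 / §4.3.1 in homological form). [cite: VoisinHodgeII2003, Thm. 4.18 (proof)] -/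
theorem Kinf_zero_eq_Kr_one_of_eHardLefschetz (hL : L.EHardLefschetz n₀) (q : ℕ) :
    C.Kinf 0 q = C.Kr 1 0 q := by
  -- all the boundaries in filtration `0` agree with `B²`
  have hBr : ∀ ρ, C.Br (ρ + 1) 0 q = C.Br 1 0 q := by
    intro ρ
    induction ρ with
    | zero => rfl
    | succ ρ ih =>
      rw [← ih]
      exact (C.Zr_Br_succ_eq_of_dZ_eq_zero
        (L.dZ_eq_zero_of_eHardLefschetz hlo hhi hL (ρ := ρ + 1) (by omega)) 0 q).2
  refine le_antisymm (fun a ha => ?_) (C.Kr_le_Kinf 1 0 q)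
  have hj : C.j 0 q a ∈ C.Binf 0 q := Submodule.mem_map_of_mem ha
  obtain ⟨ρ, hρ⟩ := C.mem_Binf_iff.1 hj
  have h1 : C.j 0 q a ∈ C.Br 1 0 q := by
    cases ρ with
    | zero => exact C.Br_mono (Nat.zero_le 1) 0 q hρ
    | succ ρ => exact hBr ρ ▸ hρ
  obtain ⟨k, hk, hka⟩ := Submodule.mem_map.1 h1
  have hinj : Function.Injective (C.j 0 q) := LinearMap.ker_eq_bot.1 (C.ker_j_zero q)
  rw [← hinj hka]
  exact hk

end Degeneration

end LefschetzEndo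

end HomologyExactCouple

end Literature.Algebra.Homology
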